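import Literature.Computability.Complexity.Hastad3SatCNF
import Literature.Computability.Complexity.GapPVRound
import HarnessLib

/-!
# Håstad's E3-CNF of a coded projection game, as a list described by number-theoretic functions

The machine level of Håstad's theorem (`hastad_seven_eighths`): the E3-CNF `CNFData.hCNF`
(`Hastad3SatCNF.lean`) of a finite projection game `G` with CNF data `D` is a `flatMap` over the finite
set of test triples, in the order of `Finset.toList` and with variables numbered by `D.nA`, `D.nB`.
When the game is CODED — edges, labels and Alice's labels enumerated by `Fin`-bijections, vertices
numbered injectively, and `src`, `dst`, `proj`, the base points `xA`, `yB` mirrored by number-theoretic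
functions (a `Coding G D g` over the numeric data `g : NumG`) — and `D` numbers the folded table entries
by the closed-form codes (`nA u f = cU u · 2^{NA} + ⟦f⟧`, `nB v g = NU 2^{NA} + cV v · 2^{NB} + ⟦g⟧`, Boolean
functions coded as bit masks over label codes), then:

* `Coding.goodNumbering` — the numbering is good (`CNFData.GoodNumbering`);
* `NumG.numCNF g` — the same multiset of clauses as an explicit list
  `(range NJ).flatMap (J ↦ replicate (bszN J) (clauseN J))` over triple codes `J`, defined from the
  numeric data ALONE (admissible labels by a bounded count over the edges, masks/nondegeneracy/
  multiplicities/literals by bit manipulations);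
* **`Coding.perm_numCNF`** — `numCNF g ~ D.hCNF` (a permutation; `CNFInvariance.lean` transports value,
  satisfiability and width).

## References

* J. Håstad, *Some optimal inapproximability results*, J. ACM 48 (2001) 798–859, §6.1 (proof of Thm 6.5:
  the test as a weighted E3-CNF) [Hastad2001].
* S. R. Buss, *Bounded Arithmetic*, Bibliopolis 1986, Ch. 1 (bounded counting) [Buss1986].
-/

noncomputable section

namespace Literature.Computability.Complexity

namespace HastadPV

open Literature.Analysis.FunctionSpaces GapPV Finset ProjGame Hastad3Sat LongCode
open Expander.LazyCSP (toNat)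

/-! ### The numeric data of a coded game and the numeric CNF -/

/-- The numeric data of a coded projection game with CNF data: code bounds `NE, NB, NA, NU`, the noise
`p/q` and `K⋆`, and the mirrors of `src`, `dst`, `proj` (`0` for "rejected", `a + 1` for "accepted with
Alice's label of code `a`"), of `xA ∘ dst` side base points (`xAN u`) and of `yB` (`yBN v`). [folklore] -/
structure NumG where
  /-- number of edge codes -/
  NE : ℕ
  /-- number of label codes (Bob) -/
  NB : ℕ
  /-- number of label codes (Alice) -/
  NA : ℕ
  /-- bound on Alice's vertex codes -/
  NU : ℕ
  /-- numerator of the noise -/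
  p : ℕ
  /-- denominator of the noise -/
  q : ℕ
  /-- the common bound `K⋆` -/
  Kst : ℕ
  /-- Bob's endpoint of an edge code -/
  srcN : ℕ → ℕ
  /-- Alice's endpoint of an edge code -/
  dstN : ℕ → ℕ
  /-- the projection of an edge code on a label code -/
  projN : ℕ → ℕ → ℕ
  /-- code of Alice's base label at an Alice vertex code -/
  xAN : ℕ → ℕ
  /-- code of Bob's base label at a Bob vertex code -/
  yBN : ℕ → ℕ

namespace NumG

variable (g : NumG)

/-- `[label code b is admissible at Bob's vertex code v]`: no edge out of `v` rejects `b`.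
[cite: Hastad2001, §6.1 (conditioning upon the constraints)] -/
def admN (v b : ℕ) : ℕ :=
  if countBelow (fun e => if g.srcN e = v then (if g.projN e b = 0 then 1 else 0) else 0) g.NE = 0 then 1 else 0

/-- The number of admissible labels at `v`. [folklore] -/
def KN (v : ℕ) : ℕ := countBelow (g.admN v) g.NB

/-- The bit mask of admissible label codes at `v`. [folklore] -/
def AMN (v : ℕ) : ℕ := ofBits (g.admN v) g.NB

/-- `[gc is the code of a Boolean function on the admissible labels at v]`: no bit outside. [folklore] -/
def validG (v gc : ℕ) : ℕ :=
  if countBelow (fun c => if g.admN v c = 0 then (Nat.testBit gc c).toNat else 0) g.NB = 0 then 1 else 0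

/-- The number of bits below `NB`. [folklore] -/
def popN (gc : ℕ) : ℕ := countBelow (fun c => (Nat.testBit gc c).toNat) g.NB

/-- The mask bit at an admissible label code `c` (edge `e`, function code `fc`, flip code `flc`):
`fl(c)` if `f(π c)` else `1`. [cite: Hastad2001, §6.1 (Test 3S, step 4)] -/
def maskBit (e fc flc c : ℕ) : ℕ := if Nat.testBit fc (g.projN e c - 1) = true then (Nat.testBit flc c).toNat else 1

/-- The code of the mask. [cite: Hastad2001, §6.1 (Test 3S, step 4)] -/
def maskN (e fc flc : ℕ) : ℕ := ofBits (fun c => g.admN (g.srcN e) c * g.maskBit e fc flc c) g.NB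

/-- `[the mask is neither identically false nor identically true]`. [cite: Hastad2001, §6.1] -/
def ndgN (e fc flc : ℕ) : ℕ :=
  if countBelow (fun c => g.admN (g.srcN e) c * g.maskBit e fc flc c) g.NB = 0 then 0
  else if countBelow (fun c => g.admN (g.srcN e) c * (1 - g.maskBit e fc flc c)) g.NB = 0 then 0 else 1

/-- The multiplicity `p^{#flips} (q-p)^{K-#flips} (2q)^{K⋆-K}`. [cite: Hastad2001, §5 (weights as multiplicities)] -/
def multN (e flc : ℕ) : ℕ :=
  g.p ^ g.popN flc * (g.q - g.p) ^ (g.KN (g.srcN e) - g.popN flc) * (2 * g.q) ^ (g.Kst - g.KN (g.srcN e))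

/-- The variable of the literal `A_{dst e}(f)`. [cite: Hastad2001, Def. 2.31] -/
def litAV (e fc : ℕ) : ℕ := g.dstN e * 2 ^ g.NA + (if Nat.testBit fc (g.xAN (g.dstN e)) = true then fc ^^^ (2 ^ g.NA - 1) else fc)

/-- The polarity of the literal `A_{dst e}(f)` (`1` = positive). [cite: Hastad2001, Def. 2.31] -/
def litAP (e fc : ℕ) : ℕ := 1 - (Nat.testBit fc (g.xAN (g.dstN e))).toNat

/-- The variable of the literal `B_{src e}(g)`. [cite: Hastad2001, Def. 2.31] -/
def litBV (e gc : ℕ) : ℕ :=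
  g.NU * 2 ^ g.NA + g.srcN e * 2 ^ g.NB + (if Nat.testBit gc (g.yBN (g.srcN e)) = true then gc ^^^ g.AMN (g.srcN e) else gc)

/-- The polarity of the literal `B_{src e}(g)`. [cite: Hastad2001, Def. 2.31] -/
def litBP (e gc : ℕ) : ℕ := 1 - (Nat.testBit gc (g.yBN (g.srcN e))).toNat

/-- The edge of a triple code. [folklore] -/
def tE (J : ℕ) : ℕ := J / (2 ^ g.NA * (2 ^ g.NB * 2 ^ g.NB))

/-- The function code `f` of a triple code. [folklore] -/
def tF (J : ℕ) : ℕ := J / (2 ^ g.NB * 2 ^ g.NB) % 2 ^ g.NA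

/-- The function code `g₁` of a triple code. [folklore] -/
def tG (J : ℕ) : ℕ := J / 2 ^ g.NB % 2 ^ g.NB

/-- The flip code of a triple code. [folklore] -/
def tL (J : ℕ) : ℕ := J % 2 ^ g.NB

/-- The variable of literal `i` of the clause of triple code `J`. [cite: Hastad2001, §6.1 (Test 3S, step 5)] -/
def litV (J i : ℕ) : ℕ :=
  if i = 0 then g.litAV (g.tE J) (g.tF J)
  else if i = 1 then g.litBV (g.tE J) (g.tG J)
  else g.litBV (g.tE J) (g.tG J ^^^ g.maskN (g.tE J) (g.tF J) (g.tL J))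

/-- The polarity of literal `i` of the clause of triple code `J`. [cite: Hastad2001, §6.1 (Test 3S, step 5)] -/
def litP (J i : ℕ) : ℕ :=
  if i = 0 then g.litAP (g.tE J) (g.tF J)
  else if i = 1 then g.litBP (g.tE J) (g.tG J)
  else g.litBP (g.tE J) (g.tG J ^^^ g.maskN (g.tE J) (g.tF J) (g.tL J))

/-- The clause of triple code `J`. [cite: Hastad2001, §6.1 (Test 3S, step 5)] -/
def clauseN (J : ℕ) : Clause ℕ := (List.range 3).map fun i => (g.litV J i, decide (g.litP J i = 1))

/-- The number of copies of the clause of triple code `J`: its multiplicity if the function codes are valid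
and the mask nondegenerate, else `0`. [cite: Hastad2001, §6.1] -/
def bszN (J : ℕ) : ℕ :=
  if g.validG (g.srcN (g.tE J)) (g.tG J) = 1 then
    (if g.validG (g.srcN (g.tE J)) (g.tL J) = 1 then (if g.ndgN (g.tE J) (g.tF J) (g.tL J) = 1 then g.multN (g.tE J) (g.tL J) else 0) else 0)
  else 0

/-- The number of triple codes. [folklore] -/
def NJ : ℕ := g.NE * (2 ^ g.NA * (2 ^ g.NB * 2 ^ g.NB))

/-- **The numeric E3-CNF.** [cite: Hastad2001, §6.1 (proof of Thm 6.5)] -/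
def numCNF : CNF ℕ := (List.range g.NJ).flatMap fun J => List.replicate (g.bszN J) (g.clauseN J)

/-! ### Elementary properties of the numeric functions -/

/-- `admN ≤ 1`. [folklore] -/
theorem admN_le (v b : ℕ) : g.admN v b ≤ 1 := by unfold admN; split_ifs <;> simp

/-- `admN = 1` iff no edge out of `v` rejects `b`. [folklore] -/
theorem admN_eq_one_iff (v b : ℕ) : g.admN v b = 1 ↔ ∀ e < g.NE, g.srcN e = v → g.projN e b ≠ 0 := by
  unfold admN
  rw [show (∀ e < g.NE, g.srcN e = v → g.projN e b ≠ 0) ↔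
      countBelow (fun e => if g.srcN e = v then (if g.projN e b = 0 then 1 else 0) else 0) g.NE = 0 from ?_]
  · split_ifs with h <;> simp [h]
  · rw [countBelow_eq_zero_iff]
    refine forall_congr' fun e => forall_congr' fun _ => ?_
    by_cases hs : g.srcN e = v <;> simp [hs]

/-- `admN = 0` iff some edge out of `v` rejects `b`. [folklore] -/
theorem admN_eq_zero_iff (v b : ℕ) : g.admN v b = 0 ↔ ¬ (∀ e < g.NE, g.srcN e = v → g.projN e b ≠ 0) := by
  rw [← admN_eq_one_iff]; have := g.admN_le v b; omega

/-- The bits of `AMN`. [folklore] -/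
theorem testBit_AMN (v i : ℕ) : (g.AMN v).testBit i = decide (i < g.NB ∧ g.admN v i = 1) :=
  testBit_ofBits (g.admN_le v) _ _

/-- `maskBit ≤ 1`. [folklore] -/
theorem maskBit_le (e fc flc c : ℕ) : g.maskBit e fc flc c ≤ 1 := by
  unfold maskBit; split_ifs <;> simp [Bool.toNat_le]

/-- The bits of `maskN`. [folklore] -/
theorem testBit_maskN (e fc flc i : ℕ) :
    (g.maskN e fc flc).testBit i = decide (i < g.NB ∧ g.admN (g.srcN e) i * g.maskBit e fc flc i = 1) :=
  testBit_ofBits (fun c => by have := g.admN_le (g.srcN e) c; have := g.maskBit_le e fc flc c; nlinarith) _ _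

/-- `validG = 1` iff every bit outside the admissible positions vanishes. [folklore] -/
theorem validG_eq_one_iff (v gc : ℕ) : g.validG v gc = 1 ↔ ∀ c < g.NB, g.admN v c = 0 → gc.testBit c = false := by
  unfold validG
  rw [show (∀ c < g.NB, g.admN v c = 0 → gc.testBit c = false) ↔
      countBelow (fun c => if g.admN v c = 0 then (Nat.testBit gc c).toNat else 0) g.NB = 0 from ?_]
  · split_ifs with h <;> simp [h]
  · rw [countBelow_eq_zero_iff]
    refine forall_congr' fun c => forall_congr' fun _ => ?_
    by_cases ha : g.admN v c = 0 <;> simp [ha]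

/-- The components of a triple code `((e · 2^{NA} + fc) 2^{NB} + gc) 2^{NB} + lc`. [folklore] -/
theorem t_decode {e fc gc lc : ℕ} (hf : fc < 2 ^ g.NA) (hg : gc < 2 ^ g.NB) (hl : lc < 2 ^ g.NB) :
    g.tE (((e * 2 ^ g.NA + fc) * 2 ^ g.NB + gc) * 2 ^ g.NB + lc) = e ∧ g.tF (((e * 2 ^ g.NA + fc) * 2 ^ g.NB + gc) * 2 ^ g.NB + lc) = fc ∧
      g.tG (((e * 2 ^ g.NA + fc) * 2 ^ g.NB + gc) * 2 ^ g.NB + lc) = gc ∧ g.tL (((e * 2 ^ g.NA + fc) * 2 ^ g.NB + gc) * 2 ^ g.NB + lc) = lc := by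
  have hB : 0 < 2 ^ g.NB := Nat.two_pow_pos _
  have hA : 0 < 2 ^ g.NA := Nat.two_pow_pos _
  have h1 : (((e * 2 ^ g.NA + fc) * 2 ^ g.NB + gc) * 2 ^ g.NB + lc) / 2 ^ g.NB = (e * 2 ^ g.NA + fc) * 2 ^ g.NB + gc := by
    rw [show ((e * 2 ^ g.NA + fc) * 2 ^ g.NB + gc) * 2 ^ g.NB + lc = lc + 2 ^ g.NB * ((e * 2 ^ g.NA + fc) * 2 ^ g.NB + gc) by ring,
      Nat.add_mul_div_left _ _ hB, Nat.div_eq_of_lt hl, zero_add]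
  have h2 : ((e * 2 ^ g.NA + fc) * 2 ^ g.NB + gc) / 2 ^ g.NB = e * 2 ^ g.NA + fc := by
    rw [show (e * 2 ^ g.NA + fc) * 2 ^ g.NB + gc = gc + 2 ^ g.NB * (e * 2 ^ g.NA + fc) by ring, Nat.add_mul_div_left _ _ hB,
      Nat.div_eq_of_lt hg, zero_add]
  have h3 : (e * 2 ^ g.NA + fc) / 2 ^ g.NA = e := by
    rw [show e * 2 ^ g.NA + fc = fc + 2 ^ g.NA * e by ring, Nat.add_mul_div_left _ _ hA, Nat.div_eq_of_lt hf, zero_add]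
  unfold tE tF tG tL
  refine ⟨?_, ?_, ?_, ?_⟩
  · rw [show 2 ^ g.NA * (2 ^ g.NB * 2 ^ g.NB) = 2 ^ g.NB * (2 ^ g.NB * 2 ^ g.NA) by ring, ← Nat.div_div_eq_div_mul, h1,
      ← Nat.div_div_eq_div_mul, h2, h3]
  · rw [← Nat.div_div_eq_div_mul, h1, h2, show e * 2 ^ g.NA + fc = fc + 2 ^ g.NA * e by ring, Nat.add_mul_mod_self_left, Nat.mod_eq_of_lt hf]
  · rw [h1, show (e * 2 ^ g.NA + fc) * 2 ^ g.NB + gc = gc + 2 ^ g.NB * (e * 2 ^ g.NA + fc) by ring, Nat.add_mul_mod_self_left, Nat.mod_eq_of_lt hg]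
  · rw [show ((e * 2 ^ g.NA + fc) * 2 ^ g.NB + gc) * 2 ^ g.NB + lc = lc + 2 ^ g.NB * ((e * 2 ^ g.NA + fc) * 2 ^ g.NB + gc) by ring,
      Nat.add_mul_mod_self_left, Nat.mod_eq_of_lt hl]

/-- The components of a triple code are below their bounds. [folklore] -/
theorem t_lt {J : ℕ} (hJ : J < g.NJ) : g.tE J < g.NE ∧ g.tF J < 2 ^ g.NA ∧ g.tG J < 2 ^ g.NB ∧ g.tL J < 2 ^ g.NB := by
  unfold tE tF tG tL
  refine ⟨?_, Nat.mod_lt _ (Nat.two_pow_pos _), Nat.mod_lt _ (Nat.two_pow_pos _), Nat.mod_lt _ (Nat.two_pow_pos _)⟩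
  unfold NJ at hJ
  exact Nat.div_lt_of_lt_mul (by rwa [mul_comm] at hJ)

/-- A triple code from its components. [folklore] -/
theorem t_recompose (J : ℕ) : J = ((g.tE J * 2 ^ g.NA + g.tF J) * 2 ^ g.NB + g.tG J) * 2 ^ g.NB + g.tL J := by
  unfold tE tF tG tL
  have e1 := Nat.div_add_mod J (2 ^ g.NB)
  have e2 := Nat.div_add_mod (J / 2 ^ g.NB) (2 ^ g.NB)
  have e3 := Nat.div_add_mod (J / 2 ^ g.NB / 2 ^ g.NB) (2 ^ g.NA)
  have h4 : J / (2 ^ g.NA * (2 ^ g.NB * 2 ^ g.NB)) = J / 2 ^ g.NB / 2 ^ g.NB / 2 ^ g.NA := by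
    rw [Nat.div_div_eq_div_mul, Nat.div_div_eq_div_mul]; congr 1; ring
  have h5 : J / (2 ^ g.NB * 2 ^ g.NB) = J / 2 ^ g.NB / 2 ^ g.NB := by rw [Nat.div_div_eq_div_mul]
  rw [h4, h5]
  calc J = 2 ^ g.NB * (J / 2 ^ g.NB) + J % 2 ^ g.NB := e1.symm
    _ = 2 ^ g.NB * (2 ^ g.NB * (J / 2 ^ g.NB / 2 ^ g.NB) + J / 2 ^ g.NB % 2 ^ g.NB) + J % 2 ^ g.NB := by rw [e2]
    _ = 2 ^ g.NB * (2 ^ g.NB * (2 ^ g.NA * (J / 2 ^ g.NB / 2 ^ g.NB / 2 ^ g.NA) + J / 2 ^ g.NB / 2 ^ g.NB % 2 ^ g.NA) +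
          J / 2 ^ g.NB % 2 ^ g.NB) + J % 2 ^ g.NB := by rw [e3]
    _ = _ := by ring

end NumG

/-! ### Coded games -/

section Typed

variable {E V U β α : Type} [Fintype E] [DecidableEq V] {G : ProjGame E V U β α} {D : G.CNFData} {g : NumG}

/-- **A coding of the game `G` with CNF data `D` over the numeric data `g`**: enumerations of the edges,
of Bob's labels and of Alice's labels, injective numberings of the vertices, the mirror equations for
`src`, `dst`, `proj`, the base points and the parameters, and the closed form of the numbering of the
folded table entries. [folklore] -/
structure Coding (G : ProjGame E V U β α) (D : G.CNFData) (g : NumG) where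
  /-- enumeration of the edges -/
  eE : E ≃ Fin g.NE
  /-- enumeration of Bob's labels -/
  eB : β ≃ Fin g.NB
  /-- enumeration of Alice's labels -/
  eA : α ≃ Fin g.NA
  /-- numbering of Bob's vertices -/
  cV : V → ℕ
  /-- numbering of Alice's vertices -/
  cU : U → ℕ
  /-- Alice's vertex numbers are `< NU` -/
  cU_lt : ∀ u, cU u < g.NU
  /-- injectivity -/
  cV_inj : Function.Injective cV
  /-- injectivity -/
  cU_inj : Function.Injective cU
  /-- `srcN` mirrors `src` -/
  src_eq : ∀ e, g.srcN (eE e) = cV (G.src e)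
  /-- `dstN` mirrors `dst` -/
  dst_eq : ∀ e, g.dstN (eE e) = cU (G.dst e)
  /-- `projN` mirrors `proj` -/
  proj_eq : ∀ e b, g.projN (eE e) (eB b) = (G.proj e b).elim 0 fun a => (eA a).val + 1
  /-- `xAN` mirrors `xA` -/
  xA_eq : ∀ u, g.xAN (cU u) = (eA (D.xA u)).val
  /-- `yBN` mirrors `yB` -/
  yB_eq : ∀ v, g.yBN (cV v) = (eB (D.yB v).1).val
  /-- the noise -/
  p_eq : D.p = g.p
  /-- the noise -/
  q_eq : D.q = g.q
  /-- the bound `K⋆` -/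
  K_eq : D.Kstar = g.Kst
  /-- the numbering of Alice's table entries -/
  nA_eq : ∀ u (f : α → Bool), D.nA u f = cU u * 2 ^ g.NA + toNat (fun i : Fin g.NA => f (eA.symm i))
  /-- the numbering of Bob's table entries -/
  nB_eq : ∀ v (gg : G.Lab v → Bool), D.nB v gg = g.NU * 2 ^ g.NA + cV v * 2 ^ g.NB +
    toNat (fun i : Fin g.NB => if h : G.Adm v (eB.symm i) then gg ⟨eB.symm i, h⟩ else false)

namespace Coding

variable (c : Coding G D g)

/-! #### Codes of Boolean functions -/

/-- The code of `f : α → Bool`: bit `eA a` is `f a`. [folklore] -/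
def fcode (f : α → Bool) : ℕ := toNat fun i : Fin g.NA => f (c.eA.symm i)

/-- A Boolean function on the admissible labels at `v`, extended by `false` to all label codes. [folklore] -/
def extB (v : V) (gg : G.Lab v → Bool) : Fin g.NB → Bool := fun i => if h : G.Adm v (c.eB.symm i) then gg ⟨c.eB.symm i, h⟩ else false

/-- The code of `g : Lab v → Bool`: bit `eB y` is `g y`, other bits vanish. [folklore] -/
def gcode (v : V) (gg : G.Lab v → Bool) : ℕ := toNat (c.extB v gg)

/-- The bits of `fcode`. [folklore] -/
theorem testBit_fcode (f : α → Bool) (a : α) : (c.fcode f).testBit (c.eA a).val = f a := by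
  unfold fcode; rw [testBit_toNat]; simp

/-- All bits of `fcode`. [folklore] -/
theorem testBit_fcode' (f : α → Bool) (i : ℕ) : (c.fcode f).testBit i = if h : i < g.NA then f (c.eA.symm ⟨i, h⟩) else false := by
  unfold fcode; rw [testBit_toNat']

/-- `fcode f < 2^{NA}`. [folklore] -/
theorem fcode_lt (f : α → Bool) : c.fcode f < 2 ^ g.NA := toNat_lt _

/-- `fcode` is injective. [folklore] -/
theorem fcode_injective : Function.Injective c.fcode := fun f f' h => by
  funext a; rw [← c.testBit_fcode f a, ← c.testBit_fcode f' a, h]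

/-- Every number `< 2^{NA}` is a code. [folklore] -/
theorem fcode_surj {m : ℕ} (hm : m < 2 ^ g.NA) : ∃ f, c.fcode f = m := by
  refine ⟨fun a => m.testBit (c.eA a).val, Nat.eq_of_testBit_eq fun i => ?_⟩
  rw [testBit_fcode']
  split_ifs with h
  · simp
  · exact (Nat.testBit_eq_false_of_lt (hm.trans_le (Nat.pow_le_pow_right two_pos (not_lt.1 h)))).symm

/-- The code of the negation: complement below `NA`. [folklore] -/
theorem fcode_not (f : α → Bool) : c.fcode (fun a => !f a) = c.fcode f ^^^ (2 ^ g.NA - 1) := by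
  apply Nat.eq_of_testBit_eq; intro i
  rw [Nat.testBit_xor, testBit_fcode', testBit_fcode', Nat.testBit_two_pow_sub_one]
  split_ifs with h <;> simp [h]

/-- The bits of `gcode` at admissible labels. [folklore] -/
theorem testBit_gcode {v : V} (gg : G.Lab v → Bool) (y : G.Lab v) : (c.gcode v gg).testBit (c.eB y.1).val = gg y := by
  unfold gcode
  rw [testBit_toNat]
  unfold extB
  have hy : c.eB.symm (c.eB y.1) = y.1 := c.eB.symm_apply_apply y.1
  rw [dif_pos (by rw [hy]; exact y.2)]
  congr 1
  exact Subtype.ext hy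

/-- All bits of `gcode`. [folklore] -/
theorem testBit_gcode' {v : V} (gg : G.Lab v → Bool) (i : ℕ) :
    (c.gcode v gg).testBit i = if h : i < g.NB then (if ha : G.Adm v (c.eB.symm ⟨i, h⟩) then gg ⟨c.eB.symm ⟨i, h⟩, ha⟩ else false) else false := by
  unfold gcode; rw [testBit_toNat']; rfl

/-- `gcode g < 2^{NB}`. [folklore] -/
theorem gcode_lt {v : V} (gg : G.Lab v → Bool) : c.gcode v gg < 2 ^ g.NB := toNat_lt _

/-- `gcode` is injective. [folklore] -/
theorem gcode_injective {v : V} {gg gg' : G.Lab v → Bool} (h : c.gcode v gg = c.gcode v gg') : gg = gg' := by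
  funext y; rw [← c.testBit_gcode gg y, ← c.testBit_gcode gg' y, h]

/-- The code of a pointwise `xor` is the bitwise `xor`. [folklore] -/
theorem gcode_shift {v : V} (gg m : G.Lab v → Bool) : c.gcode v (shift gg m) = c.gcode v gg ^^^ c.gcode v m := by
  apply Nat.eq_of_testBit_eq; intro i
  rw [Nat.testBit_xor, testBit_gcode', testBit_gcode', testBit_gcode']
  split_ifs with h ha
  · rfl
  · rfl
  · rfl

/-! #### Admissible labels -/

/-- **`admN` mirrors admissibility.** [cite: Hastad2001, §6.1 (conditioning)] -/
theorem admN_iff (v : V) (b : β) : g.admN (c.cV v) (c.eB b).val = 1 ↔ G.Adm v b := by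
  rw [g.admN_eq_one_iff]
  constructor
  · intro h e he
    have h1 := h (c.eE e).val (c.eE e).2 (by rw [c.src_eq, he])
    rw [c.proj_eq] at h1
    cases hp : G.proj e b with
    | none => rw [hp] at h1; exact absurd rfl h1
    | some a => rfl
  · intro h e' he' hs
    set e := c.eE.symm ⟨e', he'⟩ with hedef
    have hee : (c.eE e).val = e' := by rw [hedef, Equiv.apply_symm_apply]
    rw [← hee, c.src_eq] at hs
    have hv : G.src e = v := c.cV_inj hs
    have hsome := h e hv
    rw [← hee, c.proj_eq]
    cases hp : G.proj e b with
    | none => rw [hp] at hsome; exact absurd hsome (by simp)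
    | some a => exact Nat.succ_ne_zero _

/-- `admN` at a label code. [folklore] -/
theorem admN_iff' (v : V) {i : ℕ} (hi : i < g.NB) : g.admN (c.cV v) i = 1 ↔ G.Adm v (c.eB.symm ⟨i, hi⟩) := by
  rw [← c.admN_iff]; simp

/-- `admN` as a Boolean indicator at a label code. [folklore] -/
theorem admN_eq_ite (v : V) {i : ℕ} (hi : i < g.NB) :
    g.admN (c.cV v) i = if G.Adm v (c.eB.symm ⟨i, hi⟩) then 1 else 0 := by
  have h1 := c.admN_iff' v hi
  have h2 := g.admN_le (c.cV v) i
  split_ifs with h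
  · exact h1.2 h
  · have : g.admN (c.cV v) i ≠ 1 := fun h' => h (h1.1 h'); omega

/-- The bits of the admissible mask. [folklore] -/
theorem testBit_AMN_eB (v : V) (b : β) : (g.AMN (c.cV v)).testBit (c.eB b).val = decide (G.Adm v b) := by
  rw [g.testBit_AMN]
  by_cases h : G.Adm v b
  · rw [decide_eq_true h, decide_eq_true ⟨(c.eB b).2, (c.admN_iff v b).2 h⟩]
  · rw [decide_eq_false h, decide_eq_false (fun h' => h ((c.admN_iff v b).1 h'.2))]

/-- The code of the negation of `g : Lab v → Bool`: `xor` with the admissible mask. [folklore] -/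
theorem gcode_not {v : V} (gg : G.Lab v → Bool) : c.gcode v (fun y => !gg y) = c.gcode v gg ^^^ g.AMN (c.cV v) := by
  apply Nat.eq_of_testBit_eq; intro i
  rw [Nat.testBit_xor, testBit_gcode', testBit_gcode', g.testBit_AMN]
  by_cases h : i < g.NB
  · rw [dif_pos h, dif_pos h]
    by_cases ha : G.Adm v (c.eB.symm ⟨i, h⟩)
    · rw [dif_pos ha, dif_pos ha, decide_eq_true ⟨h, (c.admN_iff' v h).2 ha⟩]; simp
    · rw [dif_neg ha, dif_neg ha, decide_eq_false (fun h' => ha ((c.admN_iff' v h).1 h'.2))]; simp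
  · rw [dif_neg h, dif_neg h, decide_eq_false (fun h' => h h'.1)]; simp

/-- Codes of functions on admissible labels are valid. [folklore] -/
theorem validG_gcode {v : V} (gg : G.Lab v → Bool) : g.validG (c.cV v) (c.gcode v gg) = 1 := by
  rw [g.validG_eq_one_iff]
  intro i hi ha
  rw [testBit_gcode', dif_pos hi, dif_neg]
  intro hadm
  rw [(c.admN_iff' v hi).2 hadm] at ha
  exact one_ne_zero ha

/-- **Every valid code is the code of a function on the admissible labels.** [folklore] -/
theorem gcode_surj {v : V} {m : ℕ} (hm : m < 2 ^ g.NB) (hv : g.validG (c.cV v) m = 1) : ∃ gg : G.Lab v → Bool, c.gcode v gg = m := by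
  refine ⟨fun y => m.testBit (c.eB y.1).val, Nat.eq_of_testBit_eq fun i => ?_⟩
  rw [testBit_gcode']
  rw [g.validG_eq_one_iff] at hv
  by_cases h : i < g.NB
  · rw [dif_pos h]
    by_cases ha : G.Adm v (c.eB.symm ⟨i, h⟩)
    · rw [dif_pos ha]; simp
    · rw [dif_neg ha]
      have h0 : g.admN (c.cV v) i = 0 := by
        have := g.admN_le (c.cV v) i
        have hne : g.admN (c.cV v) i ≠ 1 := fun h1 => ha ((c.admN_iff' v h).1 h1)
        omega
      exact (hv i h h0).symm
  · rw [dif_neg h]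
    exact (Nat.testBit_eq_false_of_lt (hm.trans_le (Nat.pow_le_pow_right two_pos (not_lt.1 h)))).symm

/-- **`KN` is the number of admissible labels.** [folklore] -/
theorem KN_eq [Fintype β] (v : V) : g.KN (c.cV v) = Fintype.card (G.Lab v) := by
  unfold NumG.KN
  rw [Fintype.card_subtype]
  have hc : countBelow (g.admN (c.cV v)) g.NB = countBelow (fun i => if (i < g.NB ∧ g.admN (c.cV v) i = 1) then 1 else 0) g.NB :=
    countBelow_congr fun i hi => by
      have := g.admN_le (c.cV v) i
      by_cases h1 : g.admN (c.cV v) i = 1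
      · rw [if_pos ⟨hi, h1⟩, h1]
      · rw [if_neg (fun h => h1 h.2)]; omega
  rw [hc, countBelow_eq_length_filter, ← List.toFinset_card_of_nodup ((List.nodup_range).filter _)]
  refine (Finset.card_bij (fun b _ => (c.eB b).val) (fun b hb => ?_) (fun b₁ _ b₂ _ h => c.eB.injective (Fin.ext h)) (fun i hi => ?_)).symm
  · rw [Finset.mem_filter] at hb
    rw [List.mem_toFinset, List.mem_filter, List.mem_range]
    exact ⟨(c.eB b).2, by rw [decide_eq_true_iff]; exact ⟨(c.eB b).2, (c.admN_iff v b).2 hb.2⟩⟩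
  · rw [List.mem_toFinset, List.mem_filter, List.mem_range, decide_eq_true_iff] at hi
    refine ⟨c.eB.symm ⟨i, hi.1⟩, ?_, by simp⟩
    rw [Finset.mem_filter]
    exact ⟨Finset.mem_univ _, (c.admN_iff' v hi.1).1 hi.2.2⟩

/-- **`popN` of a code is the number of `true` values.** [folklore] -/
theorem popN_gcode [Fintype β] {v : V} (fl : G.Lab v → Bool) :
    g.popN (c.gcode v fl) = (univ.filter fun y : G.Lab v => fl y = true).card := by
  unfold NumG.popN
  have hc : countBelow (fun i => ((c.gcode v fl).testBit i).toNat) g.NB = countBelow (fun i => if (c.gcode v fl).testBit i = true then 1 else 0) g.NB :=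
    countBelow_congr fun i _ => by cases (c.gcode v fl).testBit i <;> rfl
  rw [hc, countBelow_eq_length_filter, ← List.toFinset_card_of_nodup ((List.nodup_range).filter _)]
  refine (Finset.card_bij (fun y _ => (c.eB y.1).val) (fun y hy => ?_) (fun y₁ _ y₂ _ h => Subtype.ext (c.eB.injective (Fin.ext h))) (fun i hi => ?_)).symm
  · rw [Finset.mem_filter] at hy
    rw [List.mem_toFinset, List.mem_filter, List.mem_range]
    exact ⟨(c.eB y.1).2, by rw [decide_eq_true_iff, c.testBit_gcode]; exact hy.2⟩
  · rw [List.mem_toFinset, List.mem_filter, List.mem_range, decide_eq_true_iff, c.testBit_gcode', dif_pos hi.1] at hi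
    obtain ⟨hi, hbit⟩ := hi
    by_cases ha : G.Adm v (c.eB.symm ⟨i, hi⟩)
    · rw [dif_pos ha] at hbit
      refine ⟨⟨c.eB.symm ⟨i, hi⟩, ha⟩, ?_, by simp⟩
      rw [Finset.mem_filter]
      exact ⟨Finset.mem_univ _, hbit⟩
    · rw [dif_neg ha] at hbit
      exact absurd hbit Bool.false_ne_true

/-! #### Triples: the mask, nondegeneracy and the multiplicity -/

/-- The code of the projected label. [folklore] -/
theorem projN_tproj (e : E) (y : G.Lab (G.src e)) :
    g.projN (c.eE e) (c.eB y.1).val = (c.eA (G.tproj (G.src e) (CNFData.edgeAt e) y)).val + 1 := by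
  have h : G.proj e y.1 = some (G.tproj (G.src e) (CNFData.edgeAt e) y) := G.proj_eq_some_tproj (G.src e) (CNFData.edgeAt e) y
  rw [c.proj_eq, h]; rfl

/-- **The mask bit at an admissible label.** [cite: Hastad2001, §6.1 (Test 3S, step 4)] -/
theorem maskBit_eq (t : CNFData.Trip G) (y : G.Lab (G.src t.1)) :
    g.maskBit (c.eE t.1) (c.fcode t.2.1) (c.gcode _ t.2.2.2) (c.eB y.1).val = (CNFData.maskT t y).toNat := by
  unfold NumG.maskBit CNFData.maskT mask
  rw [c.projN_tproj, Nat.add_sub_cancel, c.testBit_fcode, c.testBit_gcode]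
  cases t.2.1 (G.tproj _ (CNFData.edgeAt t.1) y) <;> simp

/-- The Bob vertex of a triple code. [folklore] -/
theorem srcN_eE (e : E) : g.srcN (c.eE e) = c.cV (G.src e) := c.src_eq e

/-- **The code of the mask.** [cite: Hastad2001, §6.1 (Test 3S, step 4)] -/
theorem gcode_maskT (t : CNFData.Trip G) : c.gcode _ (CNFData.maskT t) = g.maskN (c.eE t.1) (c.fcode t.2.1) (c.gcode _ t.2.2.2) := by
  apply Nat.eq_of_testBit_eq; intro i
  rw [g.testBit_maskN, c.testBit_gcode', c.srcN_eE]
  by_cases h : i < g.NB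
  · rw [dif_pos h]
    by_cases ha : G.Adm (G.src t.1) (c.eB.symm ⟨i, h⟩)
    · rw [dif_pos ha, (c.admN_iff' _ h).2 ha, one_mul]
      have hy : (c.eB (c.eB.symm ⟨i, h⟩)).val = i := by simp
      have hm := c.maskBit_eq t ⟨c.eB.symm ⟨i, h⟩, ha⟩
      rw [hy] at hm
      rw [hm]
      cases CNFData.maskT t ⟨c.eB.symm ⟨i, h⟩, ha⟩ <;> simp [h]
    · rw [dif_neg ha]
      have h0 : g.admN (c.cV (G.src t.1)) i = 0 := by
        have := g.admN_le (c.cV (G.src t.1)) i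
        have hne : g.admN (c.cV (G.src t.1)) i ≠ 1 := fun h1 => ha ((c.admN_iff' _ h).1 h1)
        omega
      rw [h0, zero_mul]; simp
  · rw [dif_neg h, decide_eq_false (fun h' => h h'.1)]

/-- Some admissible label has mask `true` iff some product `admN · maskBit` is nonzero. [folklore] -/
theorem exists_maskT_true_iff (t : CNFData.Trip G) :
    (∃ y, CNFData.maskT t y = true) ↔
      ∃ i < g.NB, g.admN (g.srcN (c.eE t.1)) i * g.maskBit (c.eE t.1) (c.fcode t.2.1) (c.gcode _ t.2.2.2) i ≠ 0 := by
  rw [c.srcN_eE]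
  constructor
  · rintro ⟨y, hy⟩
    refine ⟨(c.eB y.1).val, (c.eB y.1).2, ?_⟩
    rw [(c.admN_iff _ _).2 y.2, c.maskBit_eq, hy]; simp
  · rintro ⟨i, hi, hne⟩
    have ha1 : g.admN (c.cV (G.src t.1)) i = 1 := by
      have := g.admN_le (c.cV (G.src t.1)) i
      have : g.admN (c.cV (G.src t.1)) i ≠ 0 := fun h0 => hne (by rw [h0, zero_mul])
      omega
    have ha := (c.admN_iff' _ hi).1 ha1
    refine ⟨⟨c.eB.symm ⟨i, hi⟩, ha⟩, ?_⟩
    have hy : (c.eB (c.eB.symm ⟨i, hi⟩)).val = i := by simp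
    have hm := c.maskBit_eq t ⟨c.eB.symm ⟨i, hi⟩, ha⟩
    rw [hy] at hm
    rw [ha1, hm, one_mul] at hne
    cases hv : CNFData.maskT t ⟨c.eB.symm ⟨i, hi⟩, ha⟩
    · rw [hv] at hne; exact absurd rfl hne
    · rfl

/-- Some admissible label has mask `false` iff some product `admN · (1 - maskBit)` is nonzero. [folklore] -/
theorem exists_maskT_false_iff (t : CNFData.Trip G) :
    (∃ y, CNFData.maskT t y = false) ↔
      ∃ i < g.NB, g.admN (g.srcN (c.eE t.1)) i * (1 - g.maskBit (c.eE t.1) (c.fcode t.2.1) (c.gcode _ t.2.2.2) i) ≠ 0 := by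
  rw [c.srcN_eE]
  constructor
  · rintro ⟨y, hy⟩
    refine ⟨(c.eB y.1).val, (c.eB y.1).2, ?_⟩
    rw [(c.admN_iff _ _).2 y.2, c.maskBit_eq, hy]; simp
  · rintro ⟨i, hi, hne⟩
    have ha1 : g.admN (c.cV (G.src t.1)) i = 1 := by
      have := g.admN_le (c.cV (G.src t.1)) i
      have : g.admN (c.cV (G.src t.1)) i ≠ 0 := fun h0 => hne (by rw [h0, zero_mul])
      omega
    have ha := (c.admN_iff' _ hi).1 ha1
    refine ⟨⟨c.eB.symm ⟨i, hi⟩, ha⟩, ?_⟩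
    have hy : (c.eB (c.eB.symm ⟨i, hi⟩)).val = i := by simp
    have hm := c.maskBit_eq t ⟨c.eB.symm ⟨i, hi⟩, ha⟩
    rw [hy] at hm
    rw [ha1, hm, one_mul] at hne
    cases hv : CNFData.maskT t ⟨c.eB.symm ⟨i, hi⟩, ha⟩
    · rfl
    · rw [hv] at hne; exact absurd rfl hne

/-- **`ndgN` mirrors nondegeneracy.** [cite: Hastad2001, §6.1] -/
theorem ndgN_eq [Fintype β] (t : CNFData.Trip G) :
    g.ndgN (c.eE t.1) (c.fcode t.2.1) (c.gcode _ t.2.2.2) = if CNFData.Nondeg t then 1 else 0 := by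
  have h1 := c.exists_maskT_true_iff t
  have h0 := c.exists_maskT_false_iff t
  have keyA : countBelow (fun i => g.admN (g.srcN (c.eE t.1)) i * g.maskBit (c.eE t.1) (c.fcode t.2.1) (c.gcode _ t.2.2.2) i) g.NB = 0 ↔
      ¬ ∃ y, CNFData.maskT t y = true := by
    rw [countBelow_eq_zero_iff, h1]; push Not; rfl
  have keyB : countBelow (fun i => g.admN (g.srcN (c.eE t.1)) i * (1 - g.maskBit (c.eE t.1) (c.fcode t.2.1) (c.gcode _ t.2.2.2) i)) g.NB = 0 ↔
      ¬ ∃ y, CNFData.maskT t y = false := by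
    rw [countBelow_eq_zero_iff, h0]; push Not; rfl
  unfold NumG.ndgN CNFData.Nondeg
  simp only [keyA, keyB]
  by_cases hA : ∃ y, CNFData.maskT t y = true <;> by_cases hB : ∃ y, CNFData.maskT t y = false <;> simp [hA, hB]

/-- **`multN` mirrors the multiplicity.** [cite: Hastad2001, §5 (weights as multiplicities)] -/
theorem multN_eq [Fintype β] (t : CNFData.Trip G) : g.multN (c.eE t.1) (c.gcode _ t.2.2.2) = D.mult t := by
  unfold NumG.multN CNFData.mult
  rw [c.srcN_eE, c.KN_eq, c.popN_gcode, c.p_eq, c.q_eq, c.K_eq]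
  have hsplit := Finset.card_filter_add_card_filter_not (s := (univ : Finset (G.Lab (G.src t.1)))) (fun y => t.2.2.2 y = true)
  have hneg : (univ.filter fun y : G.Lab (G.src t.1) => ¬ t.2.2.2 y = true) = univ.filter fun y => t.2.2.2 y = false :=
    Finset.filter_congr fun y _ => by simp
  rw [hneg, Finset.card_univ] at hsplit
  rw [show (univ.filter fun y : G.Lab (G.src t.1) => t.2.2.2 y = false).card =
    Fintype.card (G.Lab (G.src t.1)) - (univ.filter fun y : G.Lab (G.src t.1) => t.2.2.2 y = true).card by omega]

/-! #### Triples: the literals and the clause -/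

/-- `fcode` is the code appearing in `nA`. [folklore] -/
theorem nA_eq' (u : U) (f : α → Bool) : D.nA u f = c.cU u * 2 ^ g.NA + c.fcode f := c.nA_eq u f

/-- `gcode` is the code appearing in `nB`. [folklore] -/
theorem nB_eq' (v : V) (gg : G.Lab v → Bool) : D.nB v gg = g.NU * 2 ^ g.NA + c.cV v * 2 ^ g.NB + c.gcode v gg := c.nB_eq v gg

/-- **The literal `A_{dst e}(f)`.** [cite: Hastad2001, Def. 2.31] -/
theorem litA_eq (e : E) (f : α → Bool) :
    D.litA (G.dst e) f = (g.litAV (c.eE e) (c.fcode f), decide (g.litAP (c.eE e) (c.fcode f) = 1)) := by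
  unfold CNFData.litA NumG.litAV NumG.litAP
  rw [c.dst_eq, c.xA_eq, c.testBit_fcode]
  cases f (D.xA (G.dst e))
  · simp [c.nA_eq']
  · simp [c.nA_eq', c.fcode_not]

/-- **The literal `B_{src e}(g)`.** [cite: Hastad2001, Def. 2.31] -/
theorem litB_eq (e : E) (gg : G.Lab (G.src e) → Bool) :
    D.litB (G.src e) gg = (g.litBV (c.eE e) (c.gcode _ gg), decide (g.litBP (c.eE e) (c.gcode _ gg) = 1)) := by
  unfold CNFData.litB NumG.litBV NumG.litBP
  rw [c.srcN_eE, c.yB_eq, c.testBit_gcode]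
  cases gg (D.yB (G.src e))
  · simp [c.nB_eq']
  · simp [c.nB_eq', c.gcode_not]

/-- The code of a triple. [folklore] -/
def codeT (t : CNFData.Trip G) : ℕ := (((c.eE t.1).val * 2 ^ g.NA + c.fcode t.2.1) * 2 ^ g.NB + c.gcode _ t.2.2.1) * 2 ^ g.NB + c.gcode _ t.2.2.2

/-- The components of the code of a triple. [folklore] -/
theorem t_codeT (t : CNFData.Trip G) : g.tE (c.codeT t) = (c.eE t.1).val ∧ g.tF (c.codeT t) = c.fcode t.2.1 ∧
    g.tG (c.codeT t) = c.gcode _ t.2.2.1 ∧ g.tL (c.codeT t) = c.gcode _ t.2.2.2 :=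
  g.t_decode (c.fcode_lt _) (c.gcode_lt _) (c.gcode_lt _)

/-- Codes of triples are `< NJ`. [folklore] -/
theorem codeT_lt (t : CNFData.Trip G) : c.codeT t < g.NJ := by
  unfold codeT NumG.NJ
  have hE := (c.eE t.1).2
  have hf := c.fcode_lt t.2.1
  have hg := c.gcode_lt t.2.2.1
  have hl := c.gcode_lt t.2.2.2
  set eN := (c.eE t.1).val
  set A := 2 ^ g.NA
  set B := 2 ^ g.NB
  have h1 : eN * A + c.fcode t.2.1 < g.NE * A := by nlinarith
  have h2 : (eN * A + c.fcode t.2.1) * B + c.gcode _ t.2.2.1 < g.NE * A * B := by nlinarith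
  nlinarith

/-- `codeT` is injective. [folklore] -/
theorem codeT_injective : Function.Injective c.codeT := by
  intro t t' h
  have h1 := c.t_codeT t
  have h2 := c.t_codeT t'
  rw [h] at h1
  have hE : t.1 = t'.1 := c.eE.injective (Fin.ext (h1.1.symm.trans h2.1))
  obtain ⟨e, f, g₁, fl⟩ := t
  obtain ⟨e', f', g₁', fl'⟩ := t'
  simp only at hE
  subst hE
  have hf : f = f' := c.fcode_injective (h1.2.1.symm.trans h2.2.1)
  have hg : g₁ = g₁' := c.gcode_injective (h1.2.2.1.symm.trans h2.2.2.1)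
  have hl : fl = fl' := c.gcode_injective (h1.2.2.2.symm.trans h2.2.2.2)
  subst hf hg hl
  rfl

/-- **The clause of the code of a triple is the clause of the triple.** [cite: Hastad2001, §6.1 (Test 3S, step 5)] -/
theorem clauseN_codeT (t : CNFData.Trip G) : g.clauseN (c.codeT t) = D.clauseT t := by
  obtain ⟨hE, hF, hG, hL⟩ := c.t_codeT t
  unfold NumG.clauseN CNFData.clauseT NumG.litV NumG.litP
  simp only [List.range_succ, List.range_zero, List.nil_append, List.map_cons, List.map_nil, List.cons_append]
  simp only [hE, hF, hG, hL, if_true, show (1 : ℕ) ≠ 0 from one_ne_zero, show (2 : ℕ) ≠ 0 from two_ne_zero,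
    show (2 : ℕ) ≠ 1 from by decide, if_false]
  rw [c.litA_eq, c.litB_eq, c.litB_eq, c.gcode_shift, c.gcode_maskT]

/-- **The multiplicity of the code of a triple.** [cite: Hastad2001, §6.1] -/
theorem bszN_codeT [Fintype β] (t : CNFData.Trip G) : g.bszN (c.codeT t) = if CNFData.Nondeg t then D.mult t else 0 := by
  obtain ⟨hE, hF, hG, hL⟩ := c.t_codeT t
  unfold NumG.bszN
  rw [hE, hF, hG, hL, c.srcN_eE, c.validG_gcode, c.validG_gcode, if_pos rfl, if_pos rfl, c.ndgN_eq, c.multN_eq]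
  by_cases h : CNFData.Nondeg t <;> simp [h]

/-- **Every triple code with a clause is the code of a triple.** [folklore] -/
theorem exists_codeT_eq [Fintype β] {J : ℕ} (hJ : J < g.NJ) (hb : g.bszN J ≠ 0) : ∃ t : CNFData.Trip G, c.codeT t = J := by
  obtain ⟨hE, hF, hG, hL⟩ := g.t_lt hJ
  set e := c.eE.symm ⟨g.tE J, hE⟩ with he
  have heE : (c.eE e).val = g.tE J := by rw [he, Equiv.apply_symm_apply]
  -- validity of the two function codes
  unfold NumG.bszN at hb
  have hv1 : g.validG (g.srcN (g.tE J)) (g.tG J) = 1 := by by_contra h; rw [if_neg h] at hb; exact hb rfl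
  rw [if_pos hv1] at hb
  have hv2 : g.validG (g.srcN (g.tE J)) (g.tL J) = 1 := by by_contra h; rw [if_neg h] at hb; exact hb rfl
  rw [← heE, c.srcN_eE] at hv1 hv2
  obtain ⟨f, hf⟩ := c.fcode_surj hF
  obtain ⟨g₁, hg₁⟩ := c.gcode_surj hG hv1
  obtain ⟨fl, hfl⟩ := c.gcode_surj hL hv2
  refine ⟨⟨e, f, g₁, fl⟩, ?_⟩
  unfold codeT
  rw [heE, hf, hg₁, hfl]
  exact (g.t_recompose J).symm

/-! #### The numbering is good and the numeric CNF is a permutation of `hCNF` -/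

/-- Uniqueness of quotient and remainder. [folklore] -/
theorem mul_add_inj {M a a' r r' : ℕ} (hr : r < M) (hr' : r' < M) (h : a * M + r = a' * M + r') : a = a' ∧ r = r' := by
  have hM : 0 < M := by omega
  have h1 : (a * M + r) / M = a := by rw [show a * M + r = r + M * a by ring, Nat.add_mul_div_left _ _ hM, Nat.div_eq_of_lt hr, zero_add]
  have h2 : (a' * M + r') / M = a' := by rw [show a' * M + r' = r' + M * a' by ring, Nat.add_mul_div_left _ _ hM, Nat.div_eq_of_lt hr', zero_add]
  have ha : a = a' := by rw [← h1, h, h2]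
  subst ha
  exact ⟨rfl, by omega⟩

include c in
/-- **The closed-form numbering is good.** [cite: Hastad2001, §6.1 (distinct variables)] -/
theorem goodNumbering : D.GoodNumbering where
  injA := by
    intro u u' f f' h
    rw [c.nA_eq', c.nA_eq'] at h
    obtain ⟨hu, hf⟩ := mul_add_inj (c.fcode_lt f) (c.fcode_lt f') h
    exact ⟨c.cU_inj hu, heq_of_eq (c.fcode_injective hf)⟩
  injB := by
    intro v v' gg gg' h
    rw [c.nB_eq', c.nB_eq', add_assoc, add_assoc] at h
    have h' := Nat.add_left_cancel h
    obtain ⟨hv, hg⟩ := mul_add_inj (c.gcode_lt gg) (c.gcode_lt gg') h'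
    have hvv : v = v' := c.cV_inj hv
    subst hvv
    exact ⟨rfl, heq_of_eq (c.gcode_injective hg)⟩
  disj := by
    intro u f v gg h
    rw [c.nA_eq', c.nB_eq'] at h
    have h1 := c.cU_lt u
    have h2 := c.fcode_lt f
    have : c.cU u * 2 ^ g.NA + c.fcode f < g.NU * 2 ^ g.NA := by nlinarith
    omega

/-- The count of a clause in the numeric CNF. [folklore] -/
theorem count_numCNF (cl : Clause ℕ) :
    g.numCNF.count cl = ∑ J ∈ Finset.range g.NJ, (if g.clauseN J = cl then g.bszN J else 0) := by
  unfold NumG.numCNF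
  rw [List.count_flatMap, ← List.sum_toFinset _ (List.nodup_range), List.toFinset_range]
  refine Finset.sum_congr rfl fun J _ => ?_
  rw [Function.comp_apply, List.count_replicate]
  by_cases h : g.clauseN J = cl <;> simp [h]

/-- The count of a clause in `hCNF`. [folklore] -/
theorem count_hCNF [Fintype β] [Fintype α] [DecidableEq β] [DecidableEq α] (cl : Clause ℕ) :
    D.hCNF.count cl = ∑ t : CNFData.Trip G, (if CNFData.Nondeg t then (if D.clauseT t = cl then D.mult t else 0) else 0) := by
  unfold CNFData.hCNF
  rw [List.count_flatMap, Finset.sum_map_toList, Finset.sum_filter]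
  refine Finset.sum_congr rfl fun t _ => ?_
  by_cases hn : CNFData.Nondeg t
  · rw [if_pos hn, if_pos hn, Function.comp_apply, List.count_replicate]
    by_cases h : D.clauseT t = cl <;> simp [h]
  · rw [if_neg hn, if_neg hn]

include c in
/-- **The numeric CNF is a permutation of `hCNF`.** [cite: Hastad2001, §6.1 (proof of Thm 6.5)] -/
theorem perm_numCNF [Fintype β] [Fintype α] [DecidableEq β] [DecidableEq α] : g.numCNF.Perm D.hCNF := by
  rw [List.perm_iff_count]
  intro cl
  rw [count_numCNF, count_hCNF]
  symm
  refine Finset.sum_bij_ne_zero (fun t _ _ => c.codeT t) (fun t _ _ => Finset.mem_range.2 (c.codeT_lt t))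
    (fun t₁ _ _ t₂ _ _ h => c.codeT_injective h) (fun J hJ hne => ?_) (fun t _ _ => ?_)
  · rw [Finset.mem_range] at hJ
    have hb : g.bszN J ≠ 0 := fun h0 => hne (by rw [h0]; simp)
    obtain ⟨t, ht⟩ := c.exists_codeT_eq hJ hb
    refine ⟨t, Finset.mem_univ _, ?_, ht⟩
    rw [← ht, c.clauseN_codeT, c.bszN_codeT] at hne
    by_cases hn : CNFData.Nondeg t <;> by_cases hc : D.clauseT t = cl <;> simp_all
  · rw [c.clauseN_codeT, c.bszN_codeT]
    by_cases hn : CNFData.Nondeg t <;> by_cases hc : D.clauseT t = cl <;> simp [hn, hc]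

end Coding

end Typed

end HastadPV

end Literature.Computability.Complexity

end
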